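import Summits.ResolutionOfSingularities.ResolutionOfSingularities.Theorems.MaxContactCutShadeCut
import Summits.ResolutionOfSingularities.ResolutionOfSingularities.Theorems.MaxContactCutPlanarCut
import Summits.ResolutionOfSingularities.ResolutionOfSingularities.Theorems.MaxContactCutExitLaw
import Summits.ResolutionOfSingularities.ResolutionOfSingularities.Theorems.BoundaryLedgerClasses
import Summits.ResolutionOfSingularities.ResolutionOfSingularities.Theorems.FloorCutClasses
import Literature.AlgebraicGeometry.Resolution.HasseSchmidtDiffEqDiffOp
import HarnessLib

/-!
# TightCutLawJ2 — decomp-res node «TightCut» (lens-3 g17), tree file 1/7: §J₂ **THE TIGHT CORNER LAW** —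
§J₂.1 the face identity at any
layer, §J₂.2 transport through an untranslated move, §J₂.3 the setting of LAW J₂ (`TightRepeat`) and its
ledger.  PROVED, 0 sorry.  The rest of
LAW J₂: `TightCutWitness` (§J₂.4–5), `TightCutCharts` / `TightCutCharts2` (§J₂.6); the shade-three
theorem: `TightCutPoverty`; booking:
`TightCutClasses` + `MaxContactCutTightCut`.

## The lens's node description (VERBATIM)

`MaxContactCut.DefectWalksDeep`; lens 3 = «one certified translation + split beneath»)

TARGET (tree vocabulary, BY NAME): lens-3 g16's located residual `NoJointTailsFromThreeDeep` (`ShadeCut.lean` g16, pin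
d031e7e4, :1660; restated VERBATIM in §K :2745) — the tree's JOINT RESIDUAL of 31770,
`Theorems.ExitLaw.NoRepeatTranslationRecurrentExcessPlateauxDeep` (`Theorems/ExitLawClasses.lean` :171), cut at shades
`≥ 3` (g16 `joint_iff_three`, carried :2792); the tree cut `ExitLaw.defectWalksDeep_iff_joint' :
MaxContactCut.DefectWalksDeep ↔ NoFreePointTailsDeep ∧ (joint residual)` is hypothesis-free.

NODE.  NoJointTailsFromThreeDeep ⟸ NoShadeThreeJointTailsDeep [WINDOW (s = 3, q = p^e ≥ 7 — every deep modulus but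
q = 4) · DECIDED — PROVED EMPTY `noShadeThreeJointTails_holds` :2838] ∧ NoJointTailsFromFourDeep [LOCATED RESIDUAL
(shade ≥ 4, or the tiny modulus q = 4) · NECESSARY `four_of_three` · EXACT `three_iff_four` :2890 (THE ONE CERTIFIED
EQUIV) · UNDECIDED]; composed with g16 `joint_iff_four` :2894; 31770 BY NAME `defectWalksDeep_of_four` :2898, EXACT
and hypothesis-free `defectWalksDeep_iff_four` :2904; lens-3 letters `NoTameMixedTailsDeep ↔
NoTameMixedTailsFromFourDeep` :3066, `NoMixedTailsDeep ↔ NoMixedTailsFromFourDeep` :3061 (EXACT); ONE CONJUNCTION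
CLASS with lens-5's landed
`MaxContactCutPlanarCut` letter (critic row 130; bookkeeping): `NoNonPlanarJointTailsFromFourDeep` :3081 — joint
tails of shade `≥ 4` (or `q = 4`) along NO wall — EXACT `joint_iff_nonPlanarFour` :3110,
`defectWalksDeep_iff_nonPlanarFour` :3125; root BY NAME `closes` :3140 (VERBATIM g15/g16).

THE NEW LAW (§J₂).  **LAW J₂ — the TIGHT CORNER LAW** (`TightRepeat.escape` :2478; hypotheses `structure TightRepeat`
:1628).  LAW J (g16, carried §J) leaves one corner value in play at shade 3: after an untranslated proximity repeat
`t+1` (`j_{t+1} = i ≠ j_t = j`, `b_{t+1} = 0`) on a shade-3 plateau `t … t+3` with orders `> q` at `t, t+1, t+2`, TIGHT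
means `r_{t+1}(j) + r_{t+1}(k) = q − 2`.  LAW J₂: then move `t+2` re-blows `u_i` and is translated along BOTH `u_j`
and `u_k`.  Proof in kernel: (1) the FACE IDENTITY of move `t` at every layer `o' ∈ (q, 2q)` (`coeff_succ_layer`
:1550): `coeff_{kept_t + μ + (o'−q)e_j} F_{t+1} = coeff_μ (U_t · N_t(o'))`, `U_t` the boundary cofactor, `U_t(0) ≠ 0`;
(2) with the POWER LAW (`β = 0`) the cubic face of `F_{t+1}` is `c · U_t · u_k^3` (`coeff_face` :1739), whence the
CUBIC WITNESS `u^{r_{t+1}} u_k^3`; (3) the QUARTIC WITNESS `u^{r_{t+1}} u_i^4 u_j` (`quartic_witness` :1801): the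
AXIS LAW at `t+1` for the pair `(j, k)` (tree `ConeCutAxisLaw.exists_support_pair_lt_of_isolatedTop`) gives a monomial
with `μ_j + μ_k ≤ 1` above the boundary, the cubic face excludes `μ_j = 0`, the plateau at `t+2` forces `μ_i ≥ 4` on
the face `(·, 1, 0)` (`four_le`: the chart image has degree `o_{t+1} − 3 + μ_i ≥ o_{t+2} = o_{t+1} + 1`), and that
face is the `u_i`-slice of the Cauchy product `U_t · N_t(o_t + 1)` (`deg ≤ 4`) whose MINIMAL index carries
`U_t(0) · P(y₀) ≠ 0`, so `4 ≤ y₀ ≤ 4`; (4) both witnesses pass the untranslated move `t+1` (`cubic_witness₂`,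
`quartic_witness₂`), and the cubic face of `F_{t+2}` is the single monomial `u^{r_{t+2}} u_k^3` (`face₂` :1969);
(5) move `t+2` untranslated is impossible (`untranslated_false` :2053: a witness with positive exponent above the
boundary at the chart variable drops the order at `t+3`); (6) the CONE LAW of move `t+2` (cubic residual FORM
`N = R(u + b)`, g15 `cone_of_plateau`, carried) read chart by chart through the Taylor formula
(`coeff_translate_eq_sum` :2017): chart `j`: `coeff_{u_i^2} N ≠ 0`; chart `k`: `coeff_1 N ≠ 0` (`b_j = 0`) or
`coeff_{u_i^2} N = b_j · γ ≠ 0`; chart `i`, `b_j = 0`: `coeff_1 N = b_k^3 c ≠ 0`; chart `i`, `b_k = 0 ≠ b_j`: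
translating back, `R(0) = −b_j^3 ν = 0` by the cubic face, so the witness coefficient `R(u_j) = 3 b_j^2 ν` vanishes
(`chart_i_bk0_false` :2383) — each against `deg N = 3`.  The only move left is chart `i` with `b_j ≠ 0 ≠ b_k`.

THE SHADE-THREE THEOREM (§P, `TailThree.shadeThree_tail_false` :2691).  For `q ≥ 7` no forced walk from a root
has a tail which is a shade-3 plateau with order `≠ q`, proximity repeats i.o. AND translated moves i.o.  POVERTY
LEDGER with TWO polynomial inputs (LAW J, LAW J₂): `o_t = D_t + 3 ∈ (q, 2q)`, newest mass `D_t + 3 − q ≥ 1`; a stage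
is POOR if `r_t` has a zero coordinate, and then `D_t ≤ q − 1` (P1, axis law); (P2) a translated move makes the
next stage poor; (P3⁰) an untranslated chart change INTO a zero coordinate is impossible (`repeat_into_zero_false`
:2590: it keeps all of `D_{t+1}`, the order window two moves on forces `D_{t+1} ≥ q − 2`, LAW J forces `≤ q − 2`, the
repeat is TIGHT, and LAW J₂ makes the next move leave `D = 2`, `o = 5 ≤ q`); (P3) hence poverty propagates
(`hasZero_succ` :2637); (P4) two consecutive poor stages admit no proximity repeat (`repeat_false` :2658: `D ≤ 4` two
moves on, or (P3⁰)); so after the first translation no repeat ever happens again.  The modulus `q = 4` (the only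
deep `q < 7`) stays in the residual.  The shade-two theorem of g16 is carried VERBATIM (§S) and feeds
`four_of_three`.

CARRIED VERBATIM (credited, DELETE ON LANDING): §V1, §V2 = lens-3 g16 `ShadeCut.lean` (pin d031e7e4) l.73–1019 = g15
`ConeCut.lean` rev 5 (pin f76e5309) l.140–214, l.881–1742 (walk arithmetic; state-level cone calculus and walks up to
the power law); g16's §V3 (axis law) is REPLACED by the import of the landed tree file `Theorems/ConeCutAxisLaw.lean`
(p782246); §J, §S = g16 l.1155–1631 (LAW J; the shade-two theorem); §K = g16 l.1632–1725, §L = l.1728–1816, §M =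
l.1817–1827 (g16 booking, lens letters, `closes`).  NEW in g17: §J₂ (:1526–:2494), §P, §K3, §L4, §N.  Imports are
tree-only (g16's nine + `ConeCutAxisLaw` + `MaxContactCutPlanarCut`); no HOME file is imported;
`allowUnsafeReducibility` is not used; 0 sorry.

Content VERBATIM from the decomp-res lens-3 g17 file `HOME/decomp-res-lens-3/g17/TightCut.lean` (sha256
7fe2fb69bd2eaf82, 3149 l;
HOME = run/shared/lean/pub/decomp-res).  Critic: CRITIC-LEDGER row 136 CLEARED, landing order 2026-08-30T19:49:35Z
(after node «ShadeCut» =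
`Theorems/ShadeCutLawJ`, `ShadeCutTailTwo`, `ShadeCutShadeTwo`, `MaxContactCutShadeCut`).

[WRITER NOTE (decomp-res writer g7): the lens's carried VERBATIM copies §V1/§V2 (g15 ConeCut calculus),
§J/§S/§K/§L/§M (g16 ShadeCut) are
DELETED in favour of the landed `Theorems/ConeCut*`, `ConeCutAxisLaw`, `FloorCutFloor`, `ShadeCut*`,
`MaxContactCutShadeCut` (imported and
opened; `exists_third`/`exists_ne` now the tree's `ConeCut.exists_third` / `FloorCut.exists_ne`); the by-name
`closes` re-export (§M) is not
restated; g16's `fin3_enum` (dedup of a Literature triviality) becomes a proof-local `have … := by decide` in `prod_three`.  NEW content only, split by the lens's own sections (400-line file limit): `TightCutLawJ2` (§J₂.1–§J₂.3), `TightCutWitness`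
(§J₂.4–§J₂.5), `TightCutCharts` + `TightCutCharts2` (§J₂.6), `TightCutPoverty` (§P), `TightCutClasses`
(cone-free: the two §K3 classes, home of
the aside), `MaxContactCutTightCut` (Theses cone: §K3 theorems + §L4 + §N).  ONE namespace `…Theorems.TightCut`
as in the lens; global
`set_option` line dropped; nothing else changed.]
(Sources: CossartPiltant2008 Prop. 4.2; CossartPiltant2009; CossartJannsenSaito2020; Hauser2010; Moh1987;
HauserPerlega2019; BenitoVillamayor2012; Cutkosky2009 Thm. 5.1.)
-/

noncomputable section

open MvPolynomial Finset
open Literature.AlgebraicGeometry.Resolution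
open Literature.AlgebraicGeometry.Resolution.Hauser2010
open Literature.AlgebraicGeometry.Resolution.PointBlowup
open Summit.ResolutionOfSingularities.ResolutionOfSingularities.Theses
open Summit.ResolutionOfSingularities.ResolutionOfSingularities.Theorems.TightDefectClasses
open Summit.ResolutionOfSingularities.ResolutionOfSingularities.Theorems.TightDefectStrongWalks
open Summit.ResolutionOfSingularities.ResolutionOfSingularities.Theorems.ItineraryCutClasses
open Summit.ResolutionOfSingularities.ResolutionOfSingularities.Theorems.BoundaryLedger
open Summit.ResolutionOfSingularities.ResolutionOfSingularities.Theorems.ProximityCut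
open Summit.ResolutionOfSingularities.ResolutionOfSingularities.Theorems.ConeCutAxisLaw
open Literature.AlgebraicGeometry.Resolution.WeightedBlowup
open Literature.Barriers.ResolutionOfSingularities
open Summit.ResolutionOfSingularities.ResolutionOfSingularities.Theorems.FloorCut
open Summit.ResolutionOfSingularities.ResolutionOfSingularities.Theorems.ConeCut
open Summit.ResolutionOfSingularities.ResolutionOfSingularities.Theorems.ExitLaw (fin3_cases)
open Summit.ResolutionOfSingularities.ResolutionOfSingularities.Theorems.ShadeCut

namespace Summit.ResolutionOfSingularities.ResolutionOfSingularities.Theorems.TightCut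

/-! ## §J₂  THE TIGHT CORNER LAW (new, g17)

LAW J leaves exactly one value of the corner sum at shade 3 in play: `r_{t+1}(j_t) + r_{t+1}(k) = q − 2` (TIGHT).
LAW J₂: after a tight untranslated repeat `t+1` on a shade-3 plateau `t … t+3` (orders `> q` at `t, t+1, t+2`), move
`t+2` is FORCED: it re-blows the chart of move `t+1` and is translated along BOTH other variables.  Proof in kernel
(§J₂.1–§J₂.6): the face identity of move `t` at the layers `o_t` and `o_t + 1`; the cubic witness
`u^{r_{t+1}} u_k^3` (power law) and the QUARTIC WITNESS `u^{r_{t+1}} u_i^4 u_j` (axis law at `t+1` + plateau at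
`t+2` + minimal index of a Cauchy product); their transport through the untranslated move `t+1`; the face structure
of the cubic layer of `F_{t+2}`; and a chart-by-chart reading of the cone law at move `t+2`. -/
section LawJ2

variable {K : Type} [Field K] [DecidableEq K] {q : ℕ} {s₀ : State (Fin 3) K}

/-! ### §J₂.1 The face identity at any layer -/

/-- The boundary cofactor of move `t`: `U_t = ∏_{b_t l ≠ 0} (u_l + b_t l)^{r_t l}`. DEFINITION (support). -/
def bPoly (W : ForcedWalk q s₀) (t : ℕ) : MvPolynomial (Fin 3) K :=
  translate (W.b t) (monomial ((W.st t).r.filter (fun l => W.b t l ≠ 0)) (1 : K))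

/-- `coeff_zero_bPoly`: Auxiliary step of this node's calculus, VERBATIM from the lens file (see the module
docstring); the statement is its type. [folklore] -/
theorem coeff_zero_bPoly (W : ForcedWalk q s₀) (t : ℕ) : coeff 0 (bPoly W t) = bUnit W t := rfl

/-- **THE FACE IDENTITY (PROVED)** of move `t` at ANY layer `o' ∈ (q, 2q)`: for `μ` off the chart variable,
`coeff_{kept_t + μ + (o' − q) e_{j_t}} F_{t+1} = coeff_μ (U_t · N_t(o'))`. [new] [folklore] -/
theorem coeff_succ_layer (hroot : IsRoot q s₀) (W : ForcedWalk q s₀) (t : ℕ) {o' : ℕ} (hqo : q < o')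
    (ho2 : o' < 2 * q) {μ : Fin 3 →₀ ℕ} (hμj : μ (W.j t) = 0) :
    coeff (kept W t + μ + Finsupp.single (W.j t) (o' - q)) (W.st (t + 1)).F =
      coeff μ (bPoly W t * resForm W t o') := by
  classical
  have hEj : (kept W t + μ) (W.j t) = 0 := by
    rw [Finsupp.add_apply, kept_apply, if_neg (fun h => h.1 rfl), hμj]
  rw [W.st_succ, coeff_step_layer (W.j t) (W.b t) (W.onExc t) (W.st t) hqo ho2 hEj,
    initLayer_eq_mul (W.j t) (W.st t) (walk_r hroot W t) o',
    show PointBlowup.translate (W.b t) (monomial ((W.st t).r.update (W.j t) 0) 1 * resLayer (W.j t) (W.st t) o') =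
      PointBlowup.translate (W.b t) (monomial ((W.st t).r.update (W.j t) 0) 1) *
        PointBlowup.translate (W.b t) (resLayer (W.j t) (W.st t) o') from map_mul _ _ _,
    translate_boundary_split (W.j t) (W.b t) (W.onExc t) (W.st t).r, mul_assoc, coeff_monomial_mul']
  have hk : ((W.st t).r.filter (fun l => W.b t l = 0)).erase (W.j t) = kept W t := rfl
  rw [hk, if_pos (self_le_add_right (kept W t) μ), one_mul, add_tsub_cancel_left]
  rfl

/-- Exponents of the boundary cofactor lie below the translated part of the boundary. [folklore] -/
theorem le_of_coeff_bPoly_ne_zero (W : ForcedWalk q s₀) (t : ℕ) {E : Fin 3 →₀ ℕ} (hE : coeff E (bPoly W t) ≠ 0) :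
    E ≤ (W.st t).r.filter (fun l => W.b t l ≠ 0) := by
  classical
  unfold bPoly at hE
  rw [coeff_translate_monomial, one_mul] at hE
  refine Finsupp.le_def.mpr fun l => ?_
  by_contra hlt
  push Not at hlt
  refine hE (Finset.prod_eq_zero (Finset.mem_univ l) ?_)
  rw [Nat.choose_eq_zero_of_lt hlt, Nat.cast_zero, zero_mul]

/-! ### §J₂.2 Transport through an untranslated move -/

/-- Through an UNTRANSLATED move the coefficients are carried by the chart exponent map (no collisions above degree
`q`, no cleaning off the `q`-th powers). [folklore] -/
theorem coeff_succ_of_untranslated (hroot : IsRoot q s₀) (W : ForcedWalk q s₀) (t : ℕ) (hb : W.b t = 0)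
    {m : Fin 3 →₀ ℕ} (hm : m ∈ (W.st t).F.support) (hP : ¬ IsPthPowerExponent q (chartExponent q (W.j t) m)) :
    coeff (chartExponent q (W.j t) m) (W.st (t + 1)).F = coeff m (W.st t).F := by
  classical
  rw [st_succ_F_axis W t rfl hb, coeff_deletePthPowers, if_neg hP,
    coeff_chartTransform_chartExponent _ (fun d hd => le_degree_of_mem_support hroot W t hd) hm]

/-- Every monomial after an untranslated move is the chart image of a monomial before it. [folklore] -/
theorem exists_preimage_of_untranslated (hroot : IsRoot q s₀) (W : ForcedWalk q s₀) (t : ℕ) (hb : W.b t = 0)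
    {M : Fin 3 →₀ ℕ} (hM : M ∈ (W.st (t + 1)).F.support) :
    ∃ m ∈ (W.st t).F.support, chartExponent q (W.j t) m = M ∧ coeff M (W.st (t + 1)).F = coeff m (W.st t).F := by
  classical
  have hc := mem_support_iff.mp hM
  rw [st_succ_F_axis W t rfl hb, coeff_deletePthPowers] at hc
  split_ifs at hc with hP
  · exact absurd rfl hc
  unfold chartTransform at hc
  rw [coeff_sum] at hc
  obtain ⟨m, hm, hne⟩ := Finset.exists_ne_zero_of_sum_ne_zero hc
  rw [coeff_monomial] at hne
  split_ifs at hne with heq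
  · refine ⟨m, hm, heq, ?_⟩
    rw [← heq]
    exact coeff_succ_of_untranslated hroot W t hb hm (heq ▸ hP)
  · exact absurd rfl hne

/-- Degree of a chart image: `|m⁺| + q = 2|m| − m(j)` (for `|m| ≥ q`). [folklore] -/
theorem degree_chartExponent_add (q : ℕ) (j : Fin 3) {m : Fin 3 →₀ ℕ} (hm : q ≤ m.degree) :
    (chartExponent q j m).degree + q + m j = 2 * m.degree := by
  have h1 := degree_erase_add (chartExponent q j m) j
  have h2 := degree_erase_add m j
  rw [chartExponent_erase, chartExponent_self] at h1
  omega

/-! ### §J₂.3 The setting of LAW J₂ and its ledger -/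

/-- The hypotheses of LAW J₂, bundled: a shade-3 plateau `t … t+3` with orders `> q` at `t, t+1, t+2`; move `t+1` an
UNTRANSLATED proximity repeat (`j_{t+1} ≠ j_t`, `b_{t+1} = 0`); `k` the third variable; the corner is TIGHT:
`r_{t+1}(j_t) + r_{t+1}(k) = q − 2`. DEFINITION (support). -/
structure TightRepeat (W : ForcedWalk q s₀) (t : ℕ) (k : Fin 3) : Prop where
  plat₀ : (W.st (t + 1)).shade = (W.st t).shade
  plat₁ : (W.st (t + 2)).shade = (W.st (t + 1)).shade
  plat₂ : (W.st (t + 3)).shade = (W.st (t + 2)).shade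
  three : (W.st t).shade = ((3 : ℕ) : ℕ∞)
  ex₀ : ((q : ℕ) : ℕ∞) < ordZero (W.st t).F
  ex₁ : ((q : ℕ) : ℕ∞) < ordZero (W.st (t + 1)).F
  ex₂ : ((q : ℕ) : ℕ∞) < ordZero (W.st (t + 2)).F
  ne : W.j (t + 1) ≠ W.j t
  untrans : W.b (t + 1) = 0
  ki : k ≠ W.j (t + 1)
  kj : k ≠ W.j t
  tight : (W.st (t + 1)).r (W.j t) + (W.st (t + 1)).r k + 2 = q

namespace TightRepeat

variable {W : ForcedWalk q s₀} {t : ℕ} {k : Fin 3}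

/-- `shade₁`: Auxiliary step of this node's calculus, VERBATIM from the lens file (see the module docstring); the
statement is its type. [folklore] -/
theorem shade₁ (h : TightRepeat W t k) : (W.st (t + 1)).shade = ((3 : ℕ) : ℕ∞) := h.plat₀.trans h.three

/-- `shade₂`: Auxiliary step of this node's calculus, VERBATIM from the lens file (see the module docstring); the
statement is its type. [folklore] -/
theorem shade₂ (h : TightRepeat W t k) : (W.st (t + 2)).shade = ((3 : ℕ) : ℕ∞) := h.plat₁.trans h.shade₁

/-- `shade₃`: Auxiliary step of this node's calculus, VERBATIM from the lens file (see the module docstring); the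
statement is its type. [folklore] -/
theorem shade₃ (h : TightRepeat W t k) : (W.st (t + 3)).shade = ((3 : ℕ) : ℕ∞) := h.plat₂.trans h.shade₂

/-- `stays`: Auxiliary step of this node's calculus, VERBATIM from the lens file (see the module docstring); the
statement is its type. [folklore] -/
theorem stays (h : TightRepeat W t k) : W.j (t + 1) ≠ W.j t ∧ W.b (t + 1) (W.j t) = 0 :=
  ⟨h.ne, by rw [h.untrans]; rfl⟩

/-- `bk`: Auxiliary step of this node's calculus, VERBATIM from the lens file (see the module docstring); the
statement is its type. [folklore] -/
theorem bk (h : TightRepeat W t k) : W.b (t + 1) k = 0 := by rw [h.untrans]; rfl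

/-- The three orders as natural numbers with their windows and ledgers:
`o_t = 3 + |r_t|`, `o_{t+1} = 3 + |r_{t+1}|`, `o_{t+2} = 3 + |r_{t+2}|`. [folklore] -/
theorem orders (hroot : IsRoot q s₀) (h : TightRepeat W t k) :
    ∃ o₀ o₁ o₂ : ℕ, ordZero (W.st t).F = o₀ ∧ ordZero (W.st (t + 1)).F = o₁ ∧ ordZero (W.st (t + 2)).F = o₂ ∧
      q < o₀ ∧ o₀ < 2 * q ∧ q < o₁ ∧ o₁ < 2 * q ∧ q < o₂ ∧ o₂ < 2 * q ∧
      o₀ = 3 + (W.st t).r.degree ∧ o₁ = 3 + (W.st (t + 1)).r.degree ∧ o₂ = 3 + (W.st (t + 2)).r.degree := by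
  obtain ⟨o₀, ho₀, h0, h0'⟩ := FloorCut.high_window hroot W t h.ex₀
  obtain ⟨o₁, ho₁, h1, h1'⟩ := FloorCut.high_window hroot W (t + 1) h.ex₁
  obtain ⟨o₂, ho₂, h2, h2'⟩ := FloorCut.high_window hroot W (t + 2) h.ex₂
  exact ⟨o₀, o₁, o₂, ho₀, ho₁, ho₂, h0, h0', h1, h1', h2, h2', order_eq_of_plateau hroot W ho₀ h.three,
    order_eq_of_plateau hroot W ho₁ h.shade₁, order_eq_of_plateau hroot W ho₂ h.shade₂⟩

/-- THE LEDGER OF THE TWO MOVES: `r_{t+1}(j_t) = o_t − q`; move `t+1` keeps `r_{t+1}(j_t)` and `r_{t+1}(k)` and puts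
`o_{t+1} − q` on `i = j_{t+1}`; `o_{t+1} = r_{t+1}(i) + q + 1`; `o_{t+2} = o_{t+1} + 1`. [folklore] -/
theorem ledger (hroot : IsRoot q s₀) (h : TightRepeat W t k) {o₀ o₁ o₂ : ℕ} (ho₀ : ordZero (W.st t).F = o₀)
    (ho₁ : ordZero (W.st (t + 1)).F = o₁) (ho₂ : ordZero (W.st (t + 2)).F = o₂) :
    (W.st (t + 1)).r (W.j t) + q = o₀ ∧
    (W.st (t + 2)).r (W.j (t + 1)) + q = o₁ ∧ (W.st (t + 2)).r (W.j t) = (W.st (t + 1)).r (W.j t) ∧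
    (W.st (t + 2)).r k = (W.st (t + 1)).r k ∧
    o₁ = (W.st (t + 1)).r (W.j (t + 1)) + q + 1 ∧ o₂ = o₁ + 1 ∧
    (W.st (t + 1)).r.degree + 3 = o₁ ∧ (W.st (t + 2)).r.degree + 3 = o₂ := by
  obtain ⟨p₀, p₁, p₂, hp₀, hp₁, hp₂, hq0, -, hq1, -, -, -, hd0, hd1, hd2⟩ := h.orders hroot
  have e0 : p₀ = o₀ := by have := hp₀.symm.trans ho₀; exact_mod_cast this
  have e1 : p₁ = o₁ := by have := hp₁.symm.trans ho₁; exact_mod_cast this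
  have e2 : p₂ = o₂ := by have := hp₂.symm.trans ho₂; exact_mod_cast this
  subst e0 e1 e2
  have hr₁j : (W.st (t + 1)).r (W.j t) = p₀ - q := by
    rw [r_succ_eq W t ho₀, Finsupp.add_apply, kept_apply, if_neg (fun h => h.1 rfl), Finsupp.single_eq_same,
      zero_add]
  have hr₂ : (W.st (t + 2)).r = kept W (t + 1) + Finsupp.single (W.j (t + 1)) (p₁ - q) := r_succ_eq W (t + 1) ho₁
  have hr₂i : (W.st (t + 2)).r (W.j (t + 1)) = p₁ - q := by
    rw [hr₂, Finsupp.add_apply, kept_apply, if_neg (fun h => h.1 rfl), Finsupp.single_eq_same, zero_add]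
  have hkeep : ∀ l, l ≠ W.j (t + 1) → (W.st (t + 2)).r l = (W.st (t + 1)).r l := by
    intro l hl
    rw [hr₂, Finsupp.add_apply, kept_apply, if_pos ⟨hl, by rw [h.untrans]; rfl⟩, Finsupp.single_eq_of_ne hl,
      add_zero]
  have hr₂j := hkeep (W.j t) h.ne.symm
  have hr₂k := hkeep k h.ki
  have hdeg₁ := degree_eq_three (W.st (t + 1)).r h.ne h.ki h.kj
  have hdeg₂ := degree_eq_three (W.st (t + 2)).r h.ne h.ki h.kj
  have ht := h.tight
  refine ⟨by omega, by omega, hr₂j, hr₂k, by omega, by omega, by omega, by omega⟩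

end TightRepeat

end LawJ2

end Summit.ResolutionOfSingularities.ResolutionOfSingularities.Theorems.TightCut
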